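import Mathlib
import Summits.ValiantsHypothesis.ValiantsHypothesis.Theorems.NewtonUnitEquationsDissociatedUniformTotalsLawClassBounds
import HarnessLib

/-!
# Crux `NewtonUnitEquations.DissociatedUniform` (stmt-ValiantsHypothesis-5905): the co-oriented pointwise rung needs `C ≥ 4` —
# a kernel co-oriented configuration at `q = 5` with a class of `18 > 3q` hull vertices (small-`q` excess)

Companion of `…TotalsLawClassBounds` (`@[conjecture] CoOrientedClassBound C`).  The census of memo NOTES-t1g8 §2 (`max_s V_s ≤ 2.7q` for
`q ≥ 7`) suggested `C = 3`; but at SMALL moduli the co-oriented stratum has the same kind of excess as the totals law itself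
(`…TotalsLawQuaternary`: `T = 41 > 2·4²`): integer annealing (`exp/smallq_co.py`) finds co-oriented strictly convex triples with
`max_s V_s = 14, 18, 19` at `q = 4, 5, 6` (`3q = 12, 15, 18`; never above `4q`).  This file certifies the `q = 5` instance
(`A5co, B5co, C5co`, all counter-clockwise strictly convex, injective; class `0` has `18` hull vertices of its `25` points):
**`not_coOrientedClassBound_three`**, **`four_le_of_coOrientedClassBound`**.  The located form of the rung is therefore `CoOrientedClassBound 4`
(all data: `≤ 3.6q`, and `≤ 2.7q` for `q ≥ 7`), or `V_s ≤ 3q + O(1)`.  OPEN.  Nothing here bears on VP ≠ VNP.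
[folklore: exposed points are extreme]
-/

set_option linter.dupNamespace false -- `ValiantsHypothesis.ValiantsHypothesis` (summit = problem) in every name

open scoped BigOperators

namespace Summit.ValiantsHypothesis.ValiantsHypothesis.Theorems.NewtonUnitEquationsDissociatedUniform

namespace TotalsLaw

section CoOrientedWitness5

/-- `A5co`: a strictly convex pentagon, counter-clockwise (integer annealing). -/
def A5co : ZMod 5 → ℤ × ℤ := tbl [(-31, -17), (3, -3), (33, 42), (26, 49), (-36, 20)]

/-- `B5co`: a strictly convex pentagon, counter-clockwise. -/
def B5co : ZMod 5 → ℤ × ℤ := tbl [(1487, -35), (1457, 8), (412, -1516), (1197, -1457), (1674, -1153)]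

/-- `C5co`: a strictly convex pentagon, counter-clockwise. -/
def C5co : ZMod 5 → ℤ × ℤ := tbl [(-105, 73), (-95, 69), (-16, 102), (-53, 145), (-65, 137)]

/-- The 18 certificates `((x, y), (w₁, w₂))` of the class `0`. -/
def recs5co : List ((ZMod 5 × ZMod 5) × (ℤ × ℤ)) := [((4, 2), (-1489, 988)), ((0, 2), (-35, -22)), ((3, 2), (-17, -22)), ((2, 2), (-23, -66)), ((1, 2), (14, -755)), ((1, 3), (45, -751)),
  ((0, 3), (290, -443)), ((0, 4), (289, -422)), ((1, 4), (35, -37)), ((4, 4), (109, -70)), ((2, 4), (72, -25)), ((3, 4), (218, 29)),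
  ((3, 0), (1111, 173)), ((2, 1), (6, 5)), ((2, 0), (-2, 67)), ((1, 1), (-12, 53)), ((0, 1), (-7, 13)), ((4, 1), (-1487, 1050))]

/-- All 18 certificates check, and the certified class points are pairwise distinct (`decide`). [folklore] -/
theorem recs5co_ok :
    (∀ rc ∈ recs5co, Cert₃ A5co B5co C5co 0 rc) ∧ (recs5co.map fun rc => ipt₃ A5co B5co C5co 0 rc.1).Nodup := by
  constructor <;> decide

/-- **`V ≥ 18`** for the class `0` of the `q = 5` co-oriented witness. [folklore] -/
theorem le_classVert_coWitness5 : 18 ≤ classVert (intCurve A5co) (intCurve B5co) (intCurve C5co) 0 := by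
  have h := length_le_classVert₃ A5co B5co C5co 0 recs5co recs5co_ok.1 recs5co_ok.2
  exact le_trans (by decide) h

/-- All three pentagons are in strict convex position, counter-clockwise (`decide`). [folklore] -/
theorem strictlyConvex_coWitness5 :
    StrictlyConvexCcw (intCurve A5co) ∧ StrictlyConvexCcw (intCurve B5co) ∧ StrictlyConvexCcw (intCurve C5co) :=
  ⟨strictlyConvexCcw_intCurve (by decide), strictlyConvexCcw_intCurve (by decide), strictlyConvexCcw_intCurve (by decide)⟩

/-- The three pentagons are injective (`decide`). [folklore] -/
theorem injective_coWitness5 :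
    Function.Injective (intCurve A5co) ∧ Function.Injective (intCurve B5co) ∧ Function.Injective (intCurve C5co) := by
  refine ⟨injective_intCurve ?_, injective_intCurve ?_, injective_intCurve ?_⟩ <;>
    exact fun x y h => by revert x y; decide

/-- **A co-oriented configuration at `q = 5` with a class of `18 > 3·5` vertices.** [folklore] -/
theorem exists_coOriented_fat_class5 :
    ∃ a b c : ZMod 5 → (Fin 2 → ℝ), ConvexlyOrdered a ∧ ConvexlyOrdered b ∧ ConvexlyOrdered c ∧
      Function.Injective a ∧ Function.Injective b ∧ Function.Injective c ∧
      LeftTurning a ∧ LeftTurning b ∧ LeftTurning c ∧ 18 ≤ classVert a b c 0 := by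
  have hq : 3 ≤ 5 := by norm_num
  obtain ⟨sA, sB, sC⟩ := strictlyConvex_coWitness5
  obtain ⟨hA, hB, hC⟩ := injective_coWitness5
  exact ⟨intCurve A5co, intCurve B5co, intCurve C5co,
    convexlyOrdered_of_strictlyConvexCcw sA hq, convexlyOrdered_of_strictlyConvexCcw sB hq,
    convexlyOrdered_of_strictlyConvexCcw sC hq, hA, hB, hC,
    leftTurning_of_strictlyConvexCcw sA hq, leftTurning_of_strictlyConvexCcw sB hq, leftTurning_of_strictlyConvexCcw sC hq,
    le_classVert_coWitness5⟩

/-- **`CoOrientedClassBound 3` is false** (`18 > 15` at `q = 5`). -/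
theorem not_coOrientedClassBound_three : ¬ CoOrientedClassBound 3 := by
  intro h
  obtain ⟨a, b, c, ha, hb, hc, hai, hbi, hci, la, lb, lc, hV⟩ := exists_coOriented_fat_class5
  have := h 5 a b c ha hb hc hai hbi hci (Or.inl ⟨la, lb, lc⟩) 0
  omega

/-- **The co-oriented pointwise rung needs `C ≥ 4`.** -/
theorem four_le_of_coOrientedClassBound {C : ℕ} (h : CoOrientedClassBound C) : 4 ≤ C := by
  by_contra hC
  rw [not_le] at hC
  exact not_coOrientedClassBound_three (coOrientedClassBound_mono (by omega) h)

end CoOrientedWitness5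

end TotalsLaw

end Summit.ValiantsHypothesis.ValiantsHypothesis.Theorems.NewtonUnitEquationsDissociatedUniform
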